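import Summits.HodgeConjecture.HodgeConjecture.Theses.CyclicUnitaryPowers
import Summits.HodgeConjecture.HodgeConjecture.Theorems.CyclicUnitaryPowersTorusRelation

/-!
# Stub T `stub_unitaryTorusLemma` of crux K2-A (stmt-HodgeConjecture-19545), by name: the torus lemma

The registered stub T of line `unitary-kunneth-fft` v6 (lane 2, "the lever"): for the deck-unitary weight-`2` Hodge
structure `(V, H, Q, s)` (`s` an `F`-preserving `Q`-isometry of prime order `p`, `dim V^s = 1`, `F³ = 0`, eigen-Hodge
numbers with AFFINE offsets `2(e_{j,0} - e_{j,2}) = c₀ (p - 2j)`, and `DetSupportsBalanced` at `p`), a HODGE tensor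
`t ∈ T^{r,0} V` whose `ι t` is fixed by `D(U)(ℂ)` (the elements of `U⁰(ℂ)` of determinant `1` on every eigenblock
`E_j`, `1 ≤ j < p`) is fixed by the whole connected deck-unitary group `U⁰(ℂ)` (`s_ℂ`-commuting `Q_ℂ`-isometries trivial
on `ker (s_ℂ - 1)`) — i.e. on `ℂ`-points the Hodge group is Milne's full Lefschetz group `U⁰`, not only its derived group.

Proof (all ingredients kernel-checked in the `CyclicUnitaryPowers*` helpers of this directory):
1. commutators of `U⁰(ℂ)` have determinant-`1` blocks for EVERY labelling of the eigenblocks, so the hypothesis makes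
   them fix `ι t`; by peeling (`CyclicUnitaryPowersTorusRelation.tensorSpaceActOver_eq_self_of_det_block_eq_one`) every
   `δ ∈ U⁰(ℂ)` with `det (δ|E_j) = 1` for `1 ≤ j ≤ p/2` fixes `ι t` (`D' ⊆ Stab`);
2. TORUS (`CyclicUnitaryPowersTorusRelation.sum_weight_eq_zero`): every non-zero coloured component `(ι t)_c` has
   `Σ_i ω_{c i} = 0`, `ω_j = e_{j,0} - e_{j,2}`;
3. GALOIS + MAILLET (`balanced_of_colourProj_ne_zero` below): the coloured support of the rational `t` is stable under
   `c ↦ u c` (`CyclicUnitaryPowersPrimitiveRootTransfer`), so `Σ_j d_j(c) · c₀ (p - 2 (u j mod p)) = 0` for all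
   `u ∈ [1, p)`, and `DetSupportsBalanced` gives `d_j(c) = d_{p-j}(c)`;
4. hence the centre `Z` fixes `ι t` (`CyclicUnitaryPowersDeckUnitaryCentre.tensorSpaceActOver_blockScalarUnit_eq_self_of_balanced`),
   and `U⁰(ℂ) = Z · D'` (`exists_blockScalarUnit_factor`) fixes `ι t`.
-/

noncomputable section

open Module
open scoped TensorProduct BigOperators

namespace Summit.HodgeConjecture.HodgeConjecture.Theorems.CyclicUnitaryPowersUnitaryTorusLemma

open Literature.AlgebraicGeometry.Motives
open Literature.AlgebraicGeometry.Motives.HodgeStructure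
open Summit.HodgeConjecture.HodgeConjecture.Theorems.CyclicUnitaryPowersSpectralProjectors
open Summit.HodgeConjecture.HodgeConjecture.Theorems.CyclicUnitaryPowersBlockScalars
open Summit.HodgeConjecture.HodgeConjecture.Theorems.CyclicUnitaryPowersDeckUnitaryGroup
open Summit.HodgeConjecture.HodgeConjecture.Theorems.CyclicUnitaryPowersDeckUnitaryGeneration
open Summit.HodgeConjecture.HodgeConjecture.Theorems.CyclicUnitaryPowersDeckUnitaryCommutatorsFix
open Summit.HodgeConjecture.HodgeConjecture.Theorems.CyclicUnitaryPowersDeckUnitaryCommutatorGeneration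
open Summit.HodgeConjecture.HodgeConjecture.Theorems.CyclicUnitaryPowersColourProjectors
open Summit.HodgeConjecture.HodgeConjecture.Theorems.CyclicUnitaryPowersPrimitiveRootTransfer
open Summit.HodgeConjecture.HodgeConjecture.Theorems.CyclicUnitaryPowersHodgeTorusDeck
open Summit.HodgeConjecture.HodgeConjecture.Theorems.CyclicUnitaryPowersDeckUnitaryCentre
open Summit.HodgeConjecture.HodgeConjecture.Theorems.CyclicUnitaryPowersTorusRelation

/-! ### §1 Galois + Maillet: the non-zero coloured components of a Hodge tensor are balanced -/

section Balanced

variable {V : Type} [AddCommGroup V] [Module ℚ V] [Module.Finite ℚ V]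

/-- **Balanced support.**  With the data of stub T and `D' ⊆ Stab`, every colouring `c` (colours `< p`) whose
component `P_c (ι t)` is non-zero has balanced colour counts `d_j(c) = d_{p-j}(c)`, `1 ≤ j < p`: the torus relation
`Σ_i ω_{c i} = 0` holds for all the Galois translates `u c` of `c` (the coloured support of the rational tensor `t` is
`(ℤ/p)ˣ`-stable), i.e. `Σ_j d_j(c) c₀ (p - 2 (u j mod p)) = 0` for `u ∈ [1, p)`, and `DetSupportsBalanced` (Maillet)
concludes. [folklore] -/
theorem balanced_of_colourProj_ne_zero [HodgeTensorFacts.{0, 0}] (H : HodgeStructure V ((2 : ℕ) : ℤ))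
    (Q : LinearMap.BilinForm ℚ V) (s : V →ₗ[ℚ] V) {p : ℕ} (hp : p.Prime) (h3 : 3 ≤ p) (hQn : Q.Nondegenerate)
    (hQF : ∀ (a b : ℤ) (x y : ℂ ⊗[ℚ] V), x ∈ H.F a → y ∈ H.F b → 3 ≤ a + b → Q.baseChange ℂ x y = 0)
    (hsp : s ^ p = 1) (hsQ : ∀ x y, Q (s x) (s y) = Q x y) (hsF : ∀ a : ℤ, (H.F a).map (s.baseChange ℂ) ≤ H.F a)
    (hF3 : H.F 3 = ⊥) (h1 : Module.finrank ℚ ↥(Module.End.eigenspace s 1) = 1) {ζ : ℂ} (hζ : IsPrimitiveRoot ζ p)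
    (e : ℕ → ℕ → ℕ)
    (hE : ∀ j q : ℕ, 1 ≤ j → j < p → q ≤ 2 →
      Module.finrank ℂ ↥(Module.End.eigenspace (s.baseChange ℂ) (ζ ^ j) ⊓ H.piece ((2 : ℤ) - q) q) = e j q)
    {c₀ : ℤ} (hc₀ : c₀ ≠ 0) (haff : ∀ j ∈ Finset.Ico 1 p, 2 * ((e j 0 : ℤ) - (e j 2 : ℤ)) = c₀ * ((p : ℤ) - 2 * (j : ℤ)))
    (hMaillet : ∀ c : ℤ, c ≠ 0 → ∀ m : ℕ → ℤ, (∀ t ∈ Finset.Ico 1 p,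
      ∑ j ∈ Finset.Ico 1 p, m j * (c * ((p : ℤ) - 2 * ((t * j % p : ℕ) : ℤ))) = 0) → ∀ j ∈ Finset.Ico 1 p, m j = m (p - j))
    {r : ℕ} {t : hodgeTensorSpace V r 0}
    (ht : ∃ p' : ℤ, ((r : ℤ) - ((0 : ℕ) : ℤ)) * ((2 : ℕ) : ℤ) = 2 * p' ∧ t ∈ (H.tensorSpace r 0).hodgeClasses p')
    (hS : ∀ δ ∈ centIso (s.baseChange ℂ) (Q.baseChange ℂ), (∀ j, 1 ≤ j → j ≤ p / 2 →
      LinearMap.det ((δ : ℂ ⊗[ℚ] V →ₗ[ℂ] ℂ ⊗[ℚ] V) ∘ₗ specProj (s.baseChange ℂ) ζ p j + (1 - specProj (s.baseChange ℂ) ζ p j)) = 1) →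
      tensorSpaceActOver δ (tensorSpaceToBaseChange ℂ V r 0 t) = tensorSpaceToBaseChange ℂ V r 0 t)
    (c : Fin r → ℕ) (hc : ∀ i, c i < p) (hne : colourProj (s.baseChange ℂ) ζ p c (tensorSpaceToBaseChange ℂ V r 0 t) ≠ 0) :
    ∀ j ∈ Finset.Ico 1 p, colourCount c j = colourCount c (p - j) := by
  have hp0 : 0 < p := hp.pos
  set ω : ℕ → ℤ := fun j => if j = 0 then (0 : ℤ) else (e j 0 : ℤ) - (e j 2 : ℤ) with hω
  -- the Maillet hypothesis for `m = d(c)`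
  have hrel : ∀ u ∈ Finset.Ico 1 p,
      ∑ j ∈ Finset.Ico 1 p, (colourCount c j : ℤ) * (c₀ * ((p : ℤ) - 2 * ((u * j % p : ℕ) : ℤ))) = 0 := by
    intro u hu
    have hu' := Finset.mem_Ico.mp hu
    have hndvd : ∀ k, 0 < k → k < p → ¬ p ∣ k := fun k hk0 hkp h => absurd (Nat.le_of_dvd hk0 h) (by omega)
    have hucop : u.Coprime p := Nat.Coprime.symm ((Nat.Prime.coprime_iff_not_dvd hp).mpr (hndvd u hu'.1 hu'.2))
    -- the Galois translate `u c`
    have hne' : colourProj (s.baseChange ℂ) ζ p (fun l => (u * c l) % p) (tensorSpaceToBaseChange ℂ V r 0 t) ≠ 0 :=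
      fun h => hne ((colourProj_tensorSpaceToBaseChange_eq_zero_iff_mul s hp0 hζ hucop c t).mpr h)
    have hsum := sum_weight_eq_zero H Q s hp h3 hQn hQF hsp hsQ hsF hF3 h1 hζ e hE haff ht hS (fun l => (u * c l) % p)
      (fun l => Nat.mod_lt _ hp0) hne'
    -- regroup by colours
    rw [sum_eq_sum_colourCount_smul (fun j => if (u * j) % p = 0 then (0 : ℤ) else (e ((u * j) % p) 0 : ℤ) - (e ((u * j) % p) 2 : ℤ))
      c (s := Finset.range p) (fun i => Finset.mem_range.mpr (hc i)), Finset.range_eq_Ico,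
      Finset.sum_eq_sum_Ico_succ_bot hp0, mul_zero, Nat.zero_mod, if_pos rfl, smul_zero, zero_add] at hsum
    have hsum2 : ∑ j ∈ Finset.Ico 1 p, (colourCount c j : ℤ) * (2 * (if (u * j) % p = 0 then (0 : ℤ)
        else (e ((u * j) % p) 0 : ℤ) - (e ((u * j) % p) 2 : ℤ))) = 0 := by
      have h2 : ∑ j ∈ Finset.Ico 1 p, (colourCount c j : ℤ) * (2 * (if (u * j) % p = 0 then (0 : ℤ)
          else (e ((u * j) % p) 0 : ℤ) - (e ((u * j) % p) 2 : ℤ))) =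
          2 * ∑ j ∈ Finset.Ico 1 p, colourCount c j • (if (u * j) % p = 0 then (0 : ℤ)
            else (e ((u * j) % p) 0 : ℤ) - (e ((u * j) % p) 2 : ℤ)) := by
        rw [Finset.mul_sum]
        refine Finset.sum_congr rfl fun j _ => ?_
        rw [nsmul_eq_mul]
        ring
      rw [h2, hsum, mul_zero]
    rw [← hsum2]
    refine Finset.sum_congr rfl fun j hj => ?_
    have hj' := Finset.mem_Ico.mp hj
    have hmod0 : (u * j) % p ≠ 0 := by
      intro h0
      have hdvd : p ∣ u * j := Nat.dvd_of_mod_eq_zero h0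
      rcases (Nat.Prime.dvd_mul hp).mp hdvd with h | h
      · exact hndvd u hu'.1 hu'.2 h
      · exact hndvd j hj'.1 hj'.2 h
    have hmem : (u * j) % p ∈ Finset.Ico 1 p := Finset.mem_Ico.mpr ⟨Nat.one_le_iff_ne_zero.mpr hmod0, Nat.mod_lt _ hp0⟩
    rw [if_neg hmod0, haff _ hmem]
  intro j hj
  have h := hMaillet c₀ hc₀ (fun j => (colourCount c j : ℤ)) hrel j hj
  exact_mod_cast h

end Balanced

/-! ### §2 Stub T by name -/

/-- **Stub T `UnitaryTorusLemma` (crux K2-A, line `unitary-kunneth-fft` v6, lane 2; registered signature verbatim):**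
for a Hodge tensor, invariance under the determinant-one part `D(U)(ℂ)` of the deck-unitary group upgrades to invariance
under the whole connected deck-unitary group `U⁰(ℂ)`.  On `ℂ`-points the Hodge group of the deck-unitary Hodge structure is
the full Lefschetz group `U⁰` (Deligne's torus argument for Weil-type structures with AFFINE unbalanced eigen-Hodge
numbers; the balancing is excluded by the Maillet-kernel hypothesis `DetSupportsBalanced`).
[cite: Deligne1982HodgeCycles, I §3 Prop. 3.4 and §4] -/
theorem stub_unitaryTorusLemma :
    open Literature.AlgebraicGeometry.Motives Literature.AlgebraicGeometry.HodgeTheory Literature.AlgebraicGeometry.HodgeTheory.BettiUniverse CategoryTheory.Limits in ∀ (V : Type) [AddCommGroup V] [Module ℚ V] [Module.Finite ℚ V] [HodgeTensorFacts.{0, 0}] (H : HodgeStructure V ((2 : ℕ) : ℤ)) (Q : LinearMap.BilinForm ℚ V) (s : V →ₗ[ℚ] V) (p : ℕ) (e : ℕ → ℕ → ℕ), p.Prime → 3 ≤ p → Q.Nondegenerate → (∀ x y, Q x y = Q y x) → (∀ (a b : ℤ) (x y : ℂ ⊗[ℚ] V), x ∈ H.F a → y ∈ H.F b → 3 ≤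 a + b → LinearMap.BilinForm.baseChange ℂ Q x y = 0) → s ^ p = 1 → (∀ x y, Q (s x) (s y) = Q x y) → (∀ a : ℤ, (H.F a).map (s.baseChange ℂ) ≤ H.F a) → H.F 3 = ⊥ → Module.finrank ℚ ↥(Module.End.eigenspace s 1) = 1 → (∃ ζ : ℂ, IsPrimitiveRoot ζ p ∧ ∀ j q : ℕ, 1 ≤ j → j < p → q ≤ 2 → Module.finrank ℂ ↥(Module.End.eigenspace (s.baseChange ℂ) (ζ ^ j) ⊓ H.piece ((2 : ℤ) - q) q) = e j q) → (∃ c : ℤ, c ≠ 0 ∧ ∀ j ∈ Finset.Ico 1 p, 2 * ((e j 0 : ℤ) - (e j 2 : ℤ)) = c * ((p : ℤ) - 2 * (j : ℤ))) → (∀ c : ℤ, c ≠ 0 → ∀ m : ℕ → ℤ, (∀ t ∈ Finset.Ico 1 p, ∑ j ∈ Finset.Ico 1 p, m j * (c * ((p : ℤ) - 2 * ((t * j % p : ℕ) : ℤ))) = 0) → ∀ j ∈ Finset.Ico 1 p, m j = m (p - j)) → ∀ (ζ' : ℂ), IsPrimitiveRoot ζ' p → ∀ (r : ℕ) (t : hodgeTensorSpace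 V r 0), (∃ p' : ℤ, ((r : ℤ) - ((0 : ℕ) : ℤ)) * ((2 : ℕ) : ℤ) = 2 * p' ∧ t ∈ (H.tensorSpace r 0).hodgeClasses p') → (∀ γ : (ℂ ⊗[ℚ] V) ≃ₗ[ℂ] (ℂ ⊗[ℚ] V), (∀ x, γ ((s.baseChange ℂ) x) = (s.baseChange ℂ) (γ x)) → (∀ x y, (LinearMap.BilinForm.baseChange ℂ Q) (γ x) (γ y) = (LinearMap.BilinForm.baseChange ℂ Q) x y) → (∀ x, (s.baseChange ℂ) x = x → γ x = x) → (∀ j ∈ Finset.Ico 1 p, LinearMap.det (((γ : (ℂ ⊗[ℚ] V) ≃ₗ[ℂ] (ℂ ⊗[ℚ] V)) : (ℂ ⊗[ℚ] V) →ₗ[ℂ] (ℂ ⊗[ℚ] V)) ∘ₗ (((p : ℂ)⁻¹) • ∑ i ∈ Finset.range p, (((ζ') ^ (i * j))⁻¹) • (s.baseChange ℂ) ^ i) + (1 - (((p : ℂ)⁻¹) • ∑ i ∈ Finset.range p, (((ζ') ^ (i * j))⁻¹) • (s.baseChange ℂ) ^ i))) = 1) → tensorSpaceActOver γ (tensorSpaceToBaseChange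 ℂ V r 0 t) = (tensorSpaceToBaseChange ℂ V r 0 t)) → (∀ γ : (ℂ ⊗[ℚ] V) ≃ₗ[ℂ] (ℂ ⊗[ℚ] V), (∀ x, γ ((s.baseChange ℂ) x) = (s.baseChange ℂ) (γ x)) → (∀ x y, (LinearMap.BilinForm.baseChange ℂ Q) (γ x) (γ y) = (LinearMap.BilinForm.baseChange ℂ Q) x y) → (∀ x, (s.baseChange ℂ) x = x → γ x = x) → tensorSpaceActOver γ (tensorSpaceToBaseChange ℂ V r 0 t) = (tensorSpaceToBaseChange ℂ V r 0 t)) := by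
  intro V _ _ _ _ H Q s p e hp h3 hQn hQs hQF hsp hsQ hsF hF3 h1 hE haff hMaillet ζ' hζ' r t ht hD γ hγs hγQ hγ1
  have hp0 : 0 < p := hp.pos
  have hodd : Odd p := hp.odd_of_ne_two (by omega)
  have hσ : (s.baseChange ℂ) ^ p = 1 := baseChange_pow_eq_one s hsp
  have hB : ∀ x y, Q.baseChange ℂ (s.baseChange ℂ x) (s.baseChange ℂ y) = Q.baseChange ℂ x y :=
    baseChange_isometry Q s hsQ
  have hBs : ∀ x y, Q.baseChange ℂ x y = Q.baseChange ℂ y x := baseChange_symm Q hQs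
  have hBn : (Q.baseChange ℂ).Nondegenerate := baseChange_nondegenerate Q hQn
  obtain ⟨ζ, hζ, hEζ⟩ := hE
  obtain ⟨c₀, hc₀, haffζ⟩ := haff
  have hγ : γ ∈ centIso (s.baseChange ℂ) (Q.baseChange ℂ) := ⟨hγs, hγQ, hγ1⟩
  -- (1) commutators of `U⁰(ℂ)` fix `ι t` (their blocks have determinant `1` for the labelling by `ζ'`)
  have hcomm : ∀ a ∈ centIso (s.baseChange ℂ) (Q.baseChange ℂ), ∀ b ∈ centIso (s.baseChange ℂ) (Q.baseChange ℂ),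
      tensorSpaceActOver (a * b * a⁻¹ * b⁻¹) (tensorSpaceToBaseChange ℂ V r 0 t) = tensorSpaceToBaseChange ℂ V r 0 t := by
    intro a ha b hb
    have hm : a * b * a⁻¹ * b⁻¹ ∈ centIso (s.baseChange ℂ) (Q.baseChange ℂ) :=
      mul_mem (mul_mem (mul_mem ha hb) (inv_mem ha)) (inv_mem hb)
    exact hD _ hm.1 hm.2.1 hm.2.2 fun j _ => det_block_commutator hσ hζ' hp0 ha hb j
  -- (1') hence `D' ⊆ Stab` for the labelling by `ζ`
  have hS : ∀ δ ∈ centIso (s.baseChange ℂ) (Q.baseChange ℂ), (∀ j, 1 ≤ j → j ≤ p / 2 →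
      LinearMap.det ((δ : ℂ ⊗[ℚ] V →ₗ[ℂ] ℂ ⊗[ℚ] V) ∘ₗ specProj (s.baseChange ℂ) ζ p j +
        (1 - specProj (s.baseChange ℂ) ζ p j)) = 1) →
      tensorSpaceActOver δ (tensorSpaceToBaseChange ℂ V r 0 t) = tensorSpaceToBaseChange ℂ V r 0 t :=
    fun δ hδ hdet => tensorSpaceActOver_eq_self_of_det_block_eq_one hσ hζ hp0 hodd hB hBn hBs _ hcomm hδ hdet
  -- (2)+(3) the non-zero coloured components of `ι t` are balanced, so the centre `Z` fixes `ι t`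
  have hbal := balanced_of_colourProj_ne_zero H Q s hp h3 hQn hQF hsp hsQ hsF hF3 h1 hζ e hEζ hc₀ haffζ hMaillet ht hS
  -- (4) `γ = g_λ · δ` with `g_λ ∈ Z`, `δ ∈ D'`
  obtain ⟨lam, hlam, hlam0, hrev, hdet⟩ := exists_blockScalarUnit_factor hσ hζ hp0 hodd hγ
  have hg : tensorSpaceActOver (blockScalarUnit hσ hζ hp0 lam hlam) (tensorSpaceToBaseChange ℂ V r 0 t) =
      tensorSpaceToBaseChange ℂ V r 0 t :=
    tensorSpaceActOver_blockScalarUnit_eq_self_of_balanced hσ hζ hp0 hodd lam hlam hlam0 hrev hbal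
  have hδ : tensorSpaceActOver ((blockScalarUnit hσ hζ hp0 lam hlam)⁻¹ * γ) (tensorSpaceToBaseChange ℂ V r 0 t) =
      tensorSpaceToBaseChange ℂ V r 0 t :=
    hS _ (mul_mem (inv_mem (blockScalarUnit_mem_centIso hσ hζ hp0 lam hlam hB hlam0 hrev)) hγ) hdet
  calc tensorSpaceActOver γ (tensorSpaceToBaseChange ℂ V r 0 t)
      = tensorSpaceActOver (blockScalarUnit hσ hζ hp0 lam hlam * ((blockScalarUnit hσ hζ hp0 lam hlam)⁻¹ * γ))
          (tensorSpaceToBaseChange ℂ V r 0 t) := by rw [mul_inv_cancel_left]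
    _ = tensorSpaceToBaseChange ℂ V r 0 t := by rw [tensorSpaceActOver_mul_apply, hδ, hg]

end Summit.HodgeConjecture.HodgeConjecture.Theorems.CyclicUnitaryPowersUnitaryTorusLemma

end
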